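import Literature.MathematicalPhysics.QuantumFieldTheory.Balaban1983to89.Node00.HistoryTransportOfRecord
import HarnessLib

/-!
# BalabanUVNodes ∕ node N18 = NE5 — closure-ledger item (iii): THE LATTICE STOKES INSIDE THE TWO-BLOCK BOX `B(c₋) ∪ B(c₊)` —
# the (0.4) loop variables of an `𝔸ˣ`-valued field from the plaquettes WITH ALL FOUR CORNERS IN THE TWO BLOCKS only
# (Track A, DAG node N18 = `T4OutputRate.NE5` :211; cluster K4 «SpineRates», item K3⁷ `SpineGivenEndpointR13SepCoPH`; seat pub-ymgap-dag-n18-w3 g4)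

HONEST FRAMING.  Count-neutral kernel bookkeeping (`--supports stmt-QuantumFields-20544 --as helper`): folklore lattice gauge bookkeeping around
[Balaban1985Averaging] (9), (19)–(20) and pp. 24–25 (the axial gauge), composed BY NAME from the tree's `B7Prop1Explicit` (`hol`, `U1`, `axialFn`,
`axial_bond_bound`), `B7Prop1Local` (`InBox`, `PlaqIn`, `AgreeOn`, the clamped extension `clampCfg`), `B10Eq27TorusAxialLog` (`transl`, `pull`, `holT`,
`hol_pull_zero`), `BlockAveraging` (`loopWord`, `netDisp_take_loopWord`, `blockOf_eq_of_near_emb`) and W1-18 (`Node00.W1.loopVarU`).  This is the typing point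
located by this seat's g3 ([DAGN18W3-G3-LOCATED-1], HOME bus l.29737): the tree's local Stokes letters for the (0.4) loops
(`LatticeWordStokesLocal.dist1_holAt_le_local` ∕ `BlockAveragingPlaquetteBoundLocal.dist1_loopHol_le_local`) quantify over the COUNT BOX of the loop word, which
sticks out of the two blocks into `B(c₋ − e_μ)`; the frames of [Balaban1987RG1] (1.11)∕(1.14) control only the plaquettes INSIDE the region.  Nothing of Bałaban's
renormalization group is asserted; NE5 NOT PRINTED ∕ NOT proved; N18 NOT discharged; nothing about the continuum ∕ OS ∕ mass gap ∕ Clay.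

THE MECHANISM (no swap calculus, any closed word whose walk stays in a coordinate box).  On `ℤᵈ`, in the currency `U1 = {u : ‖u‖ ≤ 1, ‖u⁻¹‖ ≤ 1}` of
`B7Prop1Explicit` (it contains `SU(N) ⊂ U(N) ⊂ M_N(ℂ)` for the operator norm): (a) in the axial gauge `V₀ = V^{v₀}` based at `y` every bond variable is within
`|b₋ − y|₁·α` of `1` when all plaquettes are within `α` of `1` (`axial_bond_bound`, [Balaban1985Averaging] p. 25 l. 3); (b) on `U1`, `‖gh − 1‖ ≤ ‖g − 1‖ + ‖h − 1‖`,
so the transport of `V₀` along ANY word whose positions stay within `ℓ¹`-radius `R` of `y` is within `|w|·R·α` of `1`, and for a CLOSED word this transport is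
conjugate by `v₀(y) = 1` to that of `V`; (c) the clamped extension `clampCfg lo hi V` of `B7Prop1Local` agrees with `V` on the bonds of the box `[lo, hi]` and each
of its plaquette variables is `1` or a plaquette variable of `V` with all four corners in the box (`hol_plaqWord_clampCfg`) — so (a)–(b) applied to it need the
plaquette hypothesis ONLY inside the box.  On the torus, W1-18's loop variable `loopVarU U c i = holT U (emb c₋) (loopWord …)` is the `ℤᵈ` transport of the periodic
pullback `pull U (emb c₋)` from `0` (`hol_pull_zero`); the walk of the loop word stays in the box `[−h, h]ᵈ + [0, L]e_μ` (`h = (L−1)∕2`, `netDisp_take_loopWord`), whose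
points are sites of `B(c₋) ∪ B(c₊)` (`blockOf_eq_of_near_emb`) and have `ℓ¹`-radius `≤ dh + L ≤ (d+2)L∕2`; the word has length `≤ (d+2)L`.

WHAT.
* §1 (`ℤᵈ`) `disp_apply_eq_netDisp`; `norm_hol_sub_one_le_length_mul` (product bound along a word inside a box whose bond variables are within `t` of `1`);
  ★ `norm_hol_closed_sub_one_le_of_radius` (global plaquette hypothesis); `clampCfg_mem_of_box`, `hol_congr_of_inBox`; ★★ `norm_hol_closed_sub_one_le_inBox`
  (plaquette hypothesis ONLY for `PlaqIn lo hi`).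
* §2 (torus) `blockOf_transl_emb` (a box point is a two-block site), `two_mul_l1_le_of_inBox` (the `ℓ¹`-radius), `inBox_disp_take_loopWord`,
  `inBox_add_e_of_inBox_add_add`, `twoBlockBox_lo_le_hi`, `pull_mem_U1_of_twoBlock`, `norm_hol_pull_plaqWord_sub_one_le_of_twoBlock` (the dictionary: the
  periodic pullback `pull U (emb c₋)` is `U1`-valued on the box bonds and its box plaquettes, both orientations, are within `a` of `1`),
  ★★★ `norm_loopVarU_sub_one_le_of_plaq_twoBlock`: for `U : GaugeField P j 𝔸ˣ` with `U b ∈ U1` on the bonds with both ends in `B(c₋) ∪ B(c₊)` and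
  `‖U(∂p) − 1‖ ≤ a` for the plaquettes with all four corners there, `‖U(Γ ∪ [x,x′] ∪ (−Γ′) ∪ (−c)) − 1‖ ≤ (((d+2)L)²∕2)·a` for every loop index (`j+1 ≤ m+K`).

0 `def`, 0 `sorry`.  References: T. Bałaban, CMP **98** (1985) 17–51 [Balaban1985Averaging] ((9) p.18, (19)–(20) p.21, pp.24–25); CMP **109** (1987) 249–301
[Balaban1987RG1] ((0.3)–(0.4) pp.252–253, (1.11) p.262).
-/

noncomputable section

open scoped BigOperators

namespace YMDAG.N18.BoxStokes

open Literature.MathematicalPhysics.QuantumFieldTheory.Balaban1983to89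
open Literature.MathematicalPhysics.QuantumFieldTheory.Balaban1983to89.B7Prop1Explicit renaming Site → LSite
open Literature.MathematicalPhysics.QuantumFieldTheory.Balaban1983to89.B7Prop1Explicit (Letter e e_apply disp disp_cons disp_nil hol hol_cons hol_nil stepHol
  stepHol_true stepHol_false l1 U1 mem_U1 norm_inv_sub_one_le hol_mem stepHol_mem gaugeAct_mem axialFn_mem gaugeAct axialFn axial_bond_bound hol_gaugeAct_closed
  plaqWord treeWord_zero)
open Literature.MathematicalPhysics.QuantumFieldTheory.Balaban1983to89.B7Prop1Local (InBox PlaqIn AgreeOn clampCfg clampCfg_agree clamp clamp_inBox clamp_add_e_of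
  norm_hol_plaqWord_clampCfg_le add_e_apply)

/-! ## §1 `ℤᵈ`: transport along a word inside a box, the axial gauge, the clamped extension -/

section Zd

variable {d : ℕ}

/-- The two displacement bookkeepings of the tree agree: `B7Prop1Explicit.disp w` read at the axis `ν` IS `T4Continuum.netDisp w ν`. [folklore] -/
theorem disp_apply_eq_netDisp : ∀ (w : List (Letter d)) (ν : Fin d), disp w ν = T4Continuum.netDisp w ν
  | [], ν => by simp [T4Continuum.netDisp]
  | (μ, b) :: w, ν => by
    rw [disp_cons, T4Continuum.netDisp_cons, Pi.add_apply, disp_apply_eq_netDisp w ν]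
    cases b
    · simp only [Letter.vec_false, Pi.neg_apply, e_apply, Bool.false_eq_true, if_false]
      by_cases h : μ = ν
      · subst h; simp
      · simp [h, Ne.symm h]
    · simp only [Letter.vec_true, e_apply, if_true]
      by_cases h : μ = ν
      · subst h; simp
      · simp [h, Ne.symm h]

variable {𝔸 : Type*} [NormedRing 𝔸] [NormOneClass 𝔸]

/-- **Transport along a word inside a box whose bond variables are near `1`** (`U1` currency): if `V` is `U1`-valued and `‖V(b) − 1‖ ≤ t` on every bond `b`
with both ends in `[lo, hi]`, then along every word all of whose positions from `x` lie in `[lo, hi]`, `‖V_x(w) − 1‖ ≤ |w|·t`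
(`‖gh − 1‖ ≤ ‖g − 1‖ + ‖h − 1‖` for `‖g‖ ≤ 1`, `‖u⁻¹ − 1‖ ≤ ‖u − 1‖` on `U1`). [cite: Balaban1985Averaging, (9) p.18 and (19)-(20) p.21] -/
theorem norm_hol_sub_one_le_length_mul {V : LSite d → Fin d → 𝔸ˣ} (hV : ∀ x κ, V x κ ∈ U1 𝔸) {lo hi : LSite d} {t : ℝ} (ht : 0 ≤ t)
    (hB : ∀ (y : LSite d) (κ : Fin d), InBox lo hi y → InBox lo hi (y + e κ) → ‖((V y κ : 𝔸ˣ) : 𝔸) - 1‖ ≤ t) :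
    ∀ (w : List (Letter d)) (x : LSite d), (∀ k, InBox lo hi (x + disp (w.take k))) →
      ‖((hol V x w : 𝔸ˣ) : 𝔸) - 1‖ ≤ w.length * t
  | [], x, _ => by simp
  | l :: w, x, hw => by
    rw [hol_cons, Units.val_mul, List.length_cons, Nat.cast_succ, add_mul, one_mul]
    have hx : InBox lo hi x := by simpa using hw 0
    have hxl : InBox lo hi (x + l.vec) := by simpa using hw 1
    have ih := norm_hol_sub_one_le_length_mul hV ht hB w (x + l.vec) fun k => by
      have := hw (k + 1)
      simpa [add_assoc] using this
    have hstep : ‖((stepHol V x l : 𝔸ˣ) : 𝔸) - 1‖ ≤ t := by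
      obtain ⟨μ, b⟩ := l
      cases b
      · rw [stepHol_false]
        have hxm : InBox lo hi (x - e μ) := by simpa [sub_eq_add_neg] using hxl
        exact (norm_inv_sub_one_le (hV _ _)).trans (hB _ μ hxm (by simpa using hx))
      · rw [stepHol_true]
        exact hB x μ hx (by simpa using hxl)
    have h1 : ‖((stepHol V x l : 𝔸ˣ) : 𝔸)‖ ≤ 1 := (mem_U1.mp (stepHol_mem hV x l)).1
    have h2 := B8Ineq170.norm_mul_sub_one_le_of_norm_le_one (b := ((hol V (x + l.vec) w : 𝔸ˣ) : 𝔸)) h1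
    linarith

/-- ★ **Closed words near `1` from a GLOBAL plaquette hypothesis, through the axial gauge** ([Balaban1985Averaging] pp. 24–25): if `V` is `U1`-valued with
`‖V(∂p) − 1‖ ≤ α` for every plaquette of `ℤᵈ`, then for every CLOSED word `w` from `y` whose positions stay in a box `[lo, hi]` of `ℓ¹`-radius `≤ R` about `y`,
`‖V_y(w) − 1‖ ≤ |w|·(R·α)` — in the axial gauge `V₀` based at `y` every bond variable of the box is within `R·α` of `1` (`axial_bond_bound`), `V₀_y(w) = V_y(w)` for
closed `w` (`v₀(y) = 1`), and §1's product bound applies. [cite: Balaban1985Averaging, pp.24-25] -/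
theorem norm_hol_closed_sub_one_le_of_radius {V : LSite d → Fin d → 𝔸ˣ} (hV : ∀ x κ, V x κ ∈ U1 𝔸) {α : ℝ} (hα : 0 ≤ α)
    (h44 : ∀ (x : LSite d) (κ μ : Fin d), κ ≠ μ → ‖((hol V x (plaqWord κ μ) : 𝔸ˣ) : 𝔸) - 1‖ ≤ α)
    {lo hi : LSite d} (y : LSite d) {R : ℝ} (hR0 : 0 ≤ R) (hR : ∀ x, InBox lo hi x → (l1 (x - y) : ℝ) ≤ R)
    (w : List (Letter d)) (hw : disp w = 0) (hwalk : ∀ k, InBox lo hi (y + disp (w.take k))) :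
    ‖((hol V y w : 𝔸ˣ) : 𝔸) - 1‖ ≤ w.length * (R * α) := by
  set V₀ := gaugeAct (axialFn V y) V with hV₀
  have hV₀m : ∀ x κ, V₀ x κ ∈ U1 𝔸 := gaugeAct_mem hV (axialFn_mem hV y)
  have hax : axialFn V y y = 1 := by simp [axialFn]
  have heq : hol V y w = hol V₀ y w := by
    rw [hV₀, hol_gaugeAct_closed _ _ _ _ hw, hax, one_mul, inv_one, mul_one]
  rw [heq]
  refine norm_hol_sub_one_le_length_mul hV₀m (mul_nonneg hR0 hα) (fun x κ hx _ => ?_) w y hwalk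
  have hb := axial_bond_bound V hV y h44 hα x κ
  rw [← hV₀] at hb
  exact hb.trans (mul_le_mul_of_nonneg_right (hR x hx) hα)

/-- The clamped extension of a configuration that is `S`-valued on the bonds of the box is `S`-valued everywhere (its non-trivial bond variables are those of
genuine box bonds). [folklore] -/
theorem clampCfg_mem_of_box {G : Type*} [Group G] {S : Subgroup G} {lo hi : LSite d} (hlohi : ∀ i, lo i ≤ hi i) {V : LSite d → Fin d → G}
    (hV : ∀ (x : LSite d) (κ : Fin d), InBox lo hi x → InBox lo hi (x + e κ) → V x κ ∈ S) (x : LSite d) (κ : Fin d) :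
    clampCfg lo hi V x κ ∈ S := by
  unfold clampCfg
  split_ifs with h
  · refine hV _ κ (clamp_inBox hlohi x) ?_
    rw [← clamp_add_e_of h]
    exact clamp_inBox hlohi _
  · exact S.one_mem

/-- Transport along a word all of whose positions lie in the box reads only the bonds of the box. [folklore] -/
theorem hol_congr_of_inBox {G : Type*} [Group G] {lo hi : LSite d} {V V' : LSite d → Fin d → G} (h : AgreeOn lo hi V V') :
    ∀ (w : List (Letter d)) (x : LSite d), (∀ k, InBox lo hi (x + disp (w.take k))) → hol V x w = hol V' x w
  | [], _, _ => by simp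
  | l :: w, x, hw => by
    have hx : InBox lo hi x := by simpa using hw 0
    have hxl : InBox lo hi (x + l.vec) := by simpa using hw 1
    have ih := hol_congr_of_inBox h w (x + l.vec) fun k => by
      have := hw (k + 1)
      simpa [add_assoc] using this
    rw [hol_cons, hol_cons, ih]
    congr 1
    obtain ⟨μ, b⟩ := l
    cases b
    · rw [stepHol_false, stepHol_false]
      have hxm : InBox lo hi (x - e μ) := by simpa [sub_eq_add_neg] using hxl
      rw [h (x - e μ) μ hxm (by simpa using hx)]
    · rw [stepHol_true, stepHol_true]
      exact h x μ hx (by simpa using hxl)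

/-- ★★ **Closed words near `1` from the plaquettes INSIDE THE BOX only**: if `V` is `U1`-valued on the bonds of `[lo, hi]` and `‖V(∂p) − 1‖ ≤ α` for every plaquette
`p` with all four corners in `[lo, hi]` (`PlaqIn`), then for every closed word `w` from `y` whose positions stay in `[lo, hi]` (`ℓ¹`-radius `≤ R` about `y`),
`‖V_y(w) − 1‖ ≤ |w|·(R·α)` — ★ applied to the clamped extension `clampCfg lo hi V`, whose plaquette variables are `1` or box plaquette variables of `V`
(`B7Prop1Local.hol_plaqWord_clampCfg`) and which agrees with `V` along `w`. [cite: Balaban1985Averaging, (19)-(20) p.21 and pp.24-25] -/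
theorem norm_hol_closed_sub_one_le_inBox {V : LSite d → Fin d → 𝔸ˣ} {lo hi : LSite d} (hlohi : ∀ i, lo i ≤ hi i)
    (hV : ∀ (x : LSite d) (κ : Fin d), InBox lo hi x → InBox lo hi (x + e κ) → V x κ ∈ U1 𝔸) {α : ℝ} (hα : 0 ≤ α)
    (h44 : ∀ (x : LSite d) (κ μ : Fin d), κ ≠ μ → PlaqIn lo hi (x, κ, μ) → ‖((hol V x (plaqWord κ μ) : 𝔸ˣ) : 𝔸) - 1‖ ≤ α)
    (y : LSite d) {R : ℝ} (hR0 : 0 ≤ R) (hR : ∀ x, InBox lo hi x → (l1 (x - y) : ℝ) ≤ R)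
    (w : List (Letter d)) (hw : disp w = 0) (hwalk : ∀ k, InBox lo hi (y + disp (w.take k))) :
    ‖((hol V y w : 𝔸ˣ) : 𝔸) - 1‖ ≤ w.length * (R * α) := by
  set V' := clampCfg lo hi V with hV'
  have hV'm : ∀ x κ, V' x κ ∈ U1 𝔸 := clampCfg_mem_of_box hlohi hV
  have h44' : ∀ (x : LSite d) (κ μ : Fin d), κ ≠ μ → ‖((hol V' x (plaqWord κ μ) : 𝔸ˣ) : 𝔸) - 1‖ ≤ α :=
    fun x κ μ hκμ => norm_hol_plaqWord_clampCfg_le hlohi V hκμ hα (fun x' hx' => h44 x' κ μ hκμ hx') x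
  have heq : hol V y w = hol V' y w := (hol_congr_of_inBox (clampCfg_agree V) w y hwalk).symm
  rw [heq]
  exact norm_hol_closed_sub_one_le_of_radius hV'm hα h44' y hR0 hR w hw hwalk

end Zd

/-! ## §2 The torus: the (0.4) loop variables from the plaquettes of the two blocks -/

section Torus

open Literature.MathematicalPhysics.QuantumFieldTheory.Balaban1983to89.T4Continuum (netDisp netDisp_cons loopWord netDisp_take_loopWord netDisp_loopWord
  blockOf_eq_of_near_emb emb_shift_apply)
open Literature.MathematicalPhysics.QuantumFieldTheory.Balaban1983to89.BlockAveraging (Idx off off_bounds)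
open Literature.MathematicalPhysics.QuantumFieldTheory.Balaban1983to89.B10Eq27TorusAxialLog (transl transl_apply transl_add_e pull pull_apply hol_pull hol_pull_zero
  holT holT_plaqWord holT_plaqWord_swap)
open Literature.MathematicalPhysics.QuantumFieldTheory.Balaban1983to89.B12RegularSpaces111 (plaq plaq_eq)
open Literature.MathematicalPhysics.QuantumFieldTheory.Balaban1983to89.Node00.W1 (loopVarU)

variable {P : Params} {j : ℕ}

/-- **A point of the box `[−h, h]ᵈ + [0, L]e_μ` about the centre `emb c₋` (`h = (L−1)∕2`) is a site of `B(c₋) ∪ B(c₊)`** (standing range `j+1 ≤ m+K`;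
`BlockAveraging.blockOf_eq_of_near_emb` about `c₋` when the `μ`-coordinate is `≤ h`, about `c₊ = c₋ + e_μ` — centre `emb c₋ + Le_μ` — otherwise).
[cite: Balaban1987RG1, (0.3)-(0.4) pp.252-253] -/
theorem blockOf_transl_emb (hj : j + 1 ≤ P.m + P.K) (c : PBond P (j + 1)) {z : LSite P.d}
    (hz : ∀ ν, -(((P.L - 1) / 2 : ℕ) : ℤ) ≤ z ν ∧ z ν ≤ (if c.dir = ν then (P.L : ℤ) else 0) + (((P.L - 1) / 2 : ℕ) : ℤ)) :
    blockOf (transl (emb c.src) z) = c.src ∨ blockOf (transl (emb c.src) z) = c.tgt := by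
  have hL := AveragingRT.two_mul_half_add_one P
  by_cases hfar : z c.dir ≤ (((P.L - 1) / 2 : ℕ) : ℤ)
  · left
    refine blockOf_eq_of_near_emb hj c.src _ z (fun ν => transl_apply _ _ ν) (fun ν => ⟨(hz ν).1, ?_⟩)
    by_cases hν : c.dir = ν
    · rw [← hν]; exact hfar
    · have := (hz ν).2; rw [if_neg hν] at this; omega
  · right
    refine blockOf_eq_of_near_emb hj c.tgt _ (fun κ => z κ - (if κ = c.dir then (P.L : ℤ) else 0)) ?_ ?_
    · intro ν
      rw [transl_apply, PBond.tgt, emb_shift_apply]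
      by_cases hν : ν = c.dir
      · rw [if_pos hν, if_pos hν]; push_cast; ring
      · rw [if_neg hν, if_neg hν, add_zero, sub_zero]
    · intro ν
      by_cases hν : ν = c.dir
      · subst hν
        have := (hz c.dir).2
        rw [if_pos rfl] at this
        rw [if_pos rfl]
        constructor <;> omega
      · rw [if_neg hν, sub_zero]
        refine ⟨(hz ν).1, ?_⟩
        have := (hz ν).2
        rw [if_neg (Ne.symm hν)] at this
        omega

/-- **The `ℓ¹`-radius of the box `[−h, h]ᵈ + [0, L]e_μ` about its centre point**: `2|z|₁ ≤ 2(dh + L) = d(L−1) + 2L ≤ (d+2)L`. [folklore] -/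
theorem two_mul_l1_le_of_inBox (c : PBond P (j + 1)) {z : LSite P.d}
    (hz : ∀ ν, -(((P.L - 1) / 2 : ℕ) : ℤ) ≤ z ν ∧ z ν ≤ (if c.dir = ν then (P.L : ℤ) else 0) + (((P.L - 1) / 2 : ℕ) : ℤ)) :
    2 * l1 z ≤ (P.d + 2) * P.L := by
  have hL := AveragingRT.two_mul_half_add_one P
  set h : ℕ := (P.L - 1) / 2 with hh
  have hle : ∀ ν, (z ν).natAbs ≤ h + (if c.dir = ν then P.L else 0) := fun ν => by
    have := hz ν
    split_ifs at this ⊢ <;> omega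
  have hsum : l1 z ≤ P.d * h + P.L := by
    unfold l1
    calc ∑ κ, (z κ).natAbs ≤ ∑ κ, (h + (if c.dir = κ then P.L else 0)) := Finset.sum_le_sum fun κ _ => hle κ
      _ = P.d * h + P.L := by
        rw [Finset.sum_add_distrib, Finset.sum_const, Finset.card_univ, Fintype.card_fin, smul_eq_mul, Finset.sum_ite_eq]
        simp
  have hid : (P.d + 2) * P.L = 2 * (P.d * h + P.L) + P.d := by rw [← hL]; ring
  omega

/-- Every position of the (0.4) loop word `Γ ∪ [x,x′] ∪ (−Γ′) ∪ (−c)` read from `0 ∈ ℤᵈ` lies in the box `[−h, h]ᵈ + [0, L]e_μ`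
(`T4Continuum.netDisp_take_loopWord` in `disp` currency). [cite: Balaban1987RG1, (0.3)-(0.4) pp.252-253] -/
theorem inBox_disp_take_loopWord (c : PBond P (j + 1)) (i : Idx P) (k : ℕ) :
    InBox (fun _ => -(((P.L - 1) / 2 : ℕ) : ℤ)) (fun ν => (if c.dir = ν then (P.L : ℤ) else 0) + (((P.L - 1) / 2 : ℕ) : ℤ))
      ((0 : LSite P.d) + disp ((loopWord P.L c.dir (off i.1) i.2.1 i.2.2).take k)) := fun ν => by
  rw [zero_add, disp_apply_eq_netDisp]
  exact netDisp_take_loopWord c.dir (off i.1) (off_bounds i.1) i.2.1 i.2.2 k ν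

/-- A unit step inside a box: if `z` and `z + e_κ + e_μ` lie in `[lo, hi]` then so does `z + e_κ` (coordinatewise betweenness). [folklore] -/
theorem inBox_add_e_of_inBox_add_add {d : ℕ} {lo hi z : LSite d} {κ μ : Fin d} (hz : InBox lo hi z) (hzκμ : InBox lo hi (z + e κ + e μ)) :
    InBox lo hi (z + e κ) := by
  refine Literature.MathematicalPhysics.QuantumFieldTheory.Balaban1983to89.B7Prop1Local.inBox_of_between hz hzκμ fun i => ?_
  simp only [Pi.add_apply, e_apply]
  split_ifs <;> omega

/-- The two-block box `[−h, h]ᵈ + [0, L]e_μ` is a genuine box (`lo ≤ hi`). [folklore] -/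
theorem twoBlockBox_lo_le_hi (c : PBond P (j + 1)) (ν : Fin P.d) :
    (fun _ => -(((P.L - 1) / 2 : ℕ) : ℤ) : LSite P.d) ν ≤ (fun ν => (if c.dir = ν then (P.L : ℤ) else 0) + (((P.L - 1) / 2 : ℕ) : ℤ) : LSite P.d) ν := by
  dsimp only
  split_ifs <;> omega

variable {𝔸 : Type*} [NormedRing 𝔸] [NormOneClass 𝔸]

/-- **The periodic pullback `pull U (emb c₋)` is `U1`-valued on the bonds of the two-block box** when `U` is `U1`-valued on the bonds with both ends in
`B(c₋) ∪ B(c₊)` (§2 dictionary + `transl_add_e`). [cite: Balaban1985Averaging, (9) p.18] -/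
theorem pull_mem_U1_of_twoBlock (hj : j + 1 ≤ P.m + P.K) {U : GaugeField P j 𝔸ˣ} (c : PBond P (j + 1))
    (hU1 : ∀ b : PBond P j, (blockOf b.src = c.src ∨ blockOf b.src = c.tgt) → (blockOf b.tgt = c.src ∨ blockOf b.tgt = c.tgt) → U b ∈ U1 𝔸)
    (z : LSite P.d) (κ : Fin P.d)
    (hz : InBox (fun _ => -(((P.L - 1) / 2 : ℕ) : ℤ)) (fun ν => (if c.dir = ν then (P.L : ℤ) else 0) + (((P.L - 1) / 2 : ℕ) : ℤ)) z)
    (hzκ : InBox (fun _ => -(((P.L - 1) / 2 : ℕ) : ℤ)) (fun ν => (if c.dir = ν then (P.L : ℤ) else 0) + (((P.L - 1) / 2 : ℕ) : ℤ)) (z + e κ)) :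
    pull U (emb c.src) z κ ∈ U1 𝔸 := by
  rw [pull_apply]
  refine hU1 _ (blockOf_transl_emb hj c (fun ν => hz ν)) ?_
  rw [PBond.tgt, ← transl_add_e]
  exact blockOf_transl_emb hj c (fun ν => hzκ ν)

/-- **The plaquette variables of the pullback inside the two-block box** (both orientations) are within `a` of `1` when the plaquettes of `U` with all four
corners in `B(c₋) ∪ B(c₊)` are (the reversed orientation is the inverse of a `U1` element: `‖u⁻¹ − 1‖ ≤ ‖u − 1‖`). [cite: Balaban1985Averaging, (9) p.19 and (19)-(20) p.21] -/
theorem norm_hol_pull_plaqWord_sub_one_le_of_twoBlock (hj : j + 1 ≤ P.m + P.K) {U : GaugeField P j 𝔸ˣ} (c : PBond P (j + 1)) {a : ℝ}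
    (hU1 : ∀ b : PBond P j, (blockOf b.src = c.src ∨ blockOf b.src = c.tgt) → (blockOf b.tgt = c.src ∨ blockOf b.tgt = c.tgt) → U b ∈ U1 𝔸)
    (hplaq : ∀ p : Plaq P j, (blockOf p.src = c.src ∨ blockOf p.src = c.tgt) →
      (blockOf (p.src.shift p.μ) = c.src ∨ blockOf (p.src.shift p.μ) = c.tgt) →
      (blockOf (p.src.shift p.ν) = c.src ∨ blockOf (p.src.shift p.ν) = c.tgt) →
      (blockOf ((p.src.shift p.μ).shift p.ν) = c.src ∨ blockOf ((p.src.shift p.μ).shift p.ν) = c.tgt) →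
      ‖((plaq U p : 𝔸ˣ) : 𝔸) - 1‖ ≤ a)
    (z : LSite P.d) (κ μ : Fin P.d) (hκμ : κ ≠ μ)
    (hp : PlaqIn (fun _ => -(((P.L - 1) / 2 : ℕ) : ℤ)) (fun ν => (if c.dir = ν then (P.L : ℤ) else 0) + (((P.L - 1) / 2 : ℕ) : ℤ)) (z, κ, μ)) :
    ‖((hol (pull U (emb c.src)) z (plaqWord κ μ) : 𝔸ˣ) : 𝔸) - 1‖ ≤ a := by
  obtain ⟨hz, hzκμ⟩ := hp
  have hzκ := inBox_add_e_of_inBox_add_add hz hzκμ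
  have hzμκ : InBox (fun _ => -(((P.L - 1) / 2 : ℕ) : ℤ)) (fun ν => (if c.dir = ν then (P.L : ℤ) else 0) + (((P.L - 1) / 2 : ℕ) : ℤ)) (z + e μ + e κ) := by
    rwa [add_right_comm]
  have hzμ := inBox_add_e_of_inBox_add_add hz hzμκ
  have c1 := blockOf_transl_emb hj c (fun ν => hz ν)
  have c2 := blockOf_transl_emb hj c (fun ν => hzκ ν)
  have c3 := blockOf_transl_emb hj c (fun ν => hzμ ν)
  have c4 := blockOf_transl_emb hj c (fun ν => hzκμ ν)
  have c4' := blockOf_transl_emb hj c (fun ν => hzμκ ν)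
  rw [transl_add_e] at c2 c3
  rw [transl_add_e, transl_add_e] at c4 c4'
  rw [hol_pull]
  rcases lt_or_gt_of_ne hκμ with hlt | hgt
  · -- `κ < μ`: the plaquette `⟨emb c₋ + z; κ, μ⟩` itself
    have h := hplaq ⟨transl (emb c.src) z, κ, μ, hlt⟩ c1 c2 c3 c4
    rwa [plaq_eq, ← holT_plaqWord] at h
  · -- `μ < κ`: the inverse of the plaquette `⟨emb c₋ + z; μ, κ⟩`, a `U1` element
    have h := hplaq ⟨transl (emb c.src) z, μ, κ, hgt⟩ c1 c3 c2 c4'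
    rw [plaq_eq, ← holT_plaqWord] at h
    have hmem : holT U (transl (emb c.src) z) (plaqWord μ κ) ∈ U1 𝔸 := by
      rw [holT_plaqWord]
      refine (U1 𝔸).mul_mem ((U1 𝔸).mul_mem ((U1 𝔸).mul_mem (hU1 _ c1 c3) (hU1 _ c3 c4')) ((U1 𝔸).inv_mem (hU1 _ c2 c4)))
        ((U1 𝔸).inv_mem (hU1 _ c1 c2))
    rw [holT_plaqWord_swap]
    exact (norm_inv_sub_one_le hmem).trans h

/-- ★★★ **THE (0.4) LOOP VARIABLES FROM THE PLAQUETTES OF THE TWO-BLOCK BOX** ([DAGN18W3-G3-LOCATED-1] discharged): for an `𝔸ˣ`-valued configuration `U`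
on `T^{(j)}` (`j+1 ≤ m+K`) whose bond variables on the bonds with both ends in `B(c₋) ∪ B(c₊)` lie in `U1 = {‖u‖ ≤ 1, ‖u⁻¹‖ ≤ 1}` (e.g. `SU(N)`-valued) and whose
plaquette variables `∂U(p)` for the plaquettes with ALL FOUR CORNERS in `B(c₋) ∪ B(c₊)` are within `a` of `1`, every loop variable
`W_i(c) = U(Γ ∪ [x,x′] ∪ (−Γ′) ∪ (−c))` of W1-18's complexified (0.4) average satisfies `‖W_i(c) − 1‖ ≤ (((d+2)L)²∕2)·a` (length `≤ (d+2)L`,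
`LatticeWordStokes.length_loopWord_le`; `ℓ¹`-radius `≤ (d+2)L∕2`; §1 ★★ on the periodic pullback `pull U (emb c₋)`).  The sharper constant `((d+2)L)²∕4` of
`LatticeWordStokes` is recovered in the sequel file by reading the axial gauge from both ends. [cite: Balaban1987RG1, (0.4) p.253; Balaban1985Averaging, (19)-(20) p.21 and pp.24-25] -/
theorem norm_loopVarU_sub_one_le_of_plaq_twoBlock (hj : j + 1 ≤ P.m + P.K) {U : GaugeField P j 𝔸ˣ} (c : PBond P (j + 1)) {a : ℝ} (ha : 0 ≤ a)
    (hU1 : ∀ b : PBond P j, (blockOf b.src = c.src ∨ blockOf b.src = c.tgt) → (blockOf b.tgt = c.src ∨ blockOf b.tgt = c.tgt) → U b ∈ U1 𝔸)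
    (hplaq : ∀ p : Plaq P j, (blockOf p.src = c.src ∨ blockOf p.src = c.tgt) →
      (blockOf (p.src.shift p.μ) = c.src ∨ blockOf (p.src.shift p.μ) = c.tgt) →
      (blockOf (p.src.shift p.ν) = c.src ∨ blockOf (p.src.shift p.ν) = c.tgt) →
      (blockOf ((p.src.shift p.μ).shift p.ν) = c.src ∨ blockOf ((p.src.shift p.μ).shift p.ν) = c.tgt) →
      ‖((plaq U p : 𝔸ˣ) : 𝔸) - 1‖ ≤ a) (i : Idx P) :
    ‖((loopVarU U c i : 𝔸ˣ) : 𝔸) - 1‖ ≤ ((((P.d + 2) * P.L : ℕ) : ℝ) ^ 2 / 2) * a := by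
  -- the `ℓ¹`-radius of the box and the walk of the loop word
  have hR : ∀ z : LSite P.d, InBox (fun _ => -(((P.L - 1) / 2 : ℕ) : ℤ)) (fun ν => (if c.dir = ν then (P.L : ℤ) else 0) + (((P.L - 1) / 2 : ℕ) : ℤ)) z →
      (l1 (z - 0) : ℝ) ≤ (((P.d + 2) * P.L : ℕ) : ℝ) / 2 := fun z hz => by
    rw [sub_zero]
    have h2 : (2 : ℝ) * (l1 z : ℝ) ≤ (((P.d + 2) * P.L : ℕ) : ℝ) := by exact_mod_cast two_mul_l1_le_of_inBox c (fun ν => hz ν)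
    linarith
  have hw0 : disp (loopWord P.L c.dir (off i.1) i.2.1 i.2.2) = 0 := funext fun ν => by
    rw [disp_apply_eq_netDisp]; exact netDisp_loopWord _ _ _ _ _ ν
  have hmain := norm_hol_closed_sub_one_le_inBox (twoBlockBox_lo_le_hi c) (pull_mem_U1_of_twoBlock hj c hU1) ha
    (norm_hol_pull_plaqWord_sub_one_le_of_twoBlock hj c hU1 hplaq) 0 (by positivity) hR _ hw0 (inBox_disp_take_loopWord c i)
  rw [hol_pull_zero] at hmain
  unfold loopVarU
  refine hmain.trans ?_
  have hlen : ((loopWord P.L c.dir (off i.1) i.2.1 i.2.2).length : ℝ) ≤ (((P.d + 2) * P.L : ℕ) : ℝ) := by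
    exact_mod_cast LatticeWordStokes.length_loopWord_le c i
  calc ((loopWord P.L c.dir (off i.1) i.2.1 i.2.2).length : ℝ) * ((((P.d + 2) * P.L : ℕ) : ℝ) / 2 * a)
        ≤ (((P.d + 2) * P.L : ℕ) : ℝ) * ((((P.d + 2) * P.L : ℕ) : ℝ) / 2 * a) := mul_le_mul_of_nonneg_right hlen (by positivity)
    _ = ((((P.d + 2) * P.L : ℕ) : ℝ) ^ 2 / 2) * a := by ring

end Torus

end YMDAG.N18.BoxStokes

end
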